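import Summits.QuantumFields.YangMills.Theorems.FluctuationComparisonRegPrIntLS2BetaWhitneyHatLiftRelative
import Summits.QuantumFields.YangMills.Theorems.FluctuationComparisonRegPrIntLS2BetaDistributedHolonomySU2
import HarnessLib

/-!
# S2β · strata residue of GAP♯∘, the (D♮) REL-TEL road — THE CHART LETTER (L♭) POINTWISE: ON SMALL FIELDS THE LOGARITHM IS `(1 + s²∕3)`-LIPSCHITZ
# AGAINST THE CHORD, `‖log a − log a₀‖ ≤ (1 + s²∕3)·dist1(a·a₀⁻¹)` for `arc a, arc a₀ ≤ s`, `s² ≤ 3` — leading constant ONE, defect `O(s²)`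

Cell `ym3-torus` (YM ladder rung R3 = continuum `SU(2)` Yang–Mills on the three-torus — a RUNG: NOT d = 4, NOT infinite volume, NOT a mass gap,
NOT Clay).  Width seat «width 12» `ym3-torus-px12` (gen 24), FREE px helper on crux `stmt-QuantumFields-20520`
(`Theses.UnitScaleTilt.FluctuationComparisonRegPrIntL`); `--kind proof --supports stmt-QuantumFields-20520 --as helper`, count-neutral, DEFINITION-FREE
(0 `def`, 0 `instance`, 0 `notation`, 0 `sorry`, default heartbeats).

WHY.  The REL-TEL DOCK `…S2BetaRelGaugeOfRelativeLetter.dockRel_inner` ∕ `relGauge_of_letter` (this seat, v2) runs the two-tower recursion of (D♮) in the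
REGISTERED chord currency `dist1(a·a₀⁻¹) = ‖su2Quat a − su2Quat a₀‖_ℍ`, where the bond split is exact group algebra and the relative lift inequality (R1) is
px12 g23's OPERATOR fact ✓`sum_dist1_sq_lift_mul_inv_le` — whose RIGHT side is in LOG currency.  Closing the loop costs exactly one displayed letter (L♭)
«`‖log U′_{j+1} − log U′₀_{j+1}‖_{ℓ²} ≤ (1 + r_j)·‖dist1(U′_{j+1}·U′₀_{j+1}⁻¹)‖_{ℓ²}`» with a SUMMABLE defect `r`.  The tree had the logarithm `6`-Lipschitz on the
half-ball (✓`…UniformGaugeRoot.norm_logVec_sub_logVec_le`) and `arc ≤ (π∕2)·chord` (✓`norm_logVec_le_pi_div_two_mul_dist1`) — constants that are NOT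
`1 + (summable)`.  THIS FILE proves the sharp small-field form: the defect is `s²∕3` with `s` the sup of the two arcs (own lineage, UV3-NODE §71 addendum:
the `(s∕sin s)` factor; §71 erratum: depth-free in stage gauges because `s = s_{j+1}` is geometric, so `Σ_j s_{j+1}² < ∞` by px16 g20's sup budget).
* §1 `mu_mul_abs_le_abs_sin` (`(1 − s²∕6)·|x| ≤ |sin x|` for `|x| ≤ s`, `s² ≤ 6`; Mathlib `Real.sin_ge_sub_cube`), `mu_sq_mul_sq_le_two_sub_two_cos`
  (`(1 − s²∕6)²·y² ≤ 2 − 2cos y` for `|y| ≤ 2s`).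
* §2 ★★ `norm_sub_le_mul_norm_exp_imQuat_sub` — **`‖v − w‖ ≤ (1 + s²∕3)·‖exp(ιv) − exp(ιw)‖` for `‖v‖, ‖w‖ ≤ s`, `s² ≤ 3`**: the REVERSE of px12 g23's sharp
  ✓`norm_exp_imQuat_sub_exp_imQuat_le_norm_sub` by the same device — `‖exp(ιv) − exp(ιw)‖² = 2 − 2cos‖v‖cos‖w‖ − 2·sinc‖v‖·sinc‖w‖·⟪v,w⟫` and `‖v − w‖²`
  are both AFFINE in `⟪v, w⟫ ∈ [−‖v‖‖w‖, ‖v‖‖w‖]`, and at the two endpoints the claim is §1 at `y = ‖v‖ ∓ ‖w‖`.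
* §3 ★★ `norm_logVec_sub_le_mul_dist1` (the `SU(2)` reading: `‖log a − log a₀‖ ≤ (1 + s²∕3)·dist1(a·a₀⁻¹)` under `arc a, arc a₀ ≤ s`),
  `norm_logVec_sub_le_mul_dist1_of_dist1_le` (guards in `dist1` currency via Jordan: `dist1 ≤ δ` ⟹ `arc ≤ (π∕2)δ`), and the `ℓ²` form
  ★★ `sqrt_sum_sq_norm_logVec_sub_le` = (L♭) at ONE level with `r := s²∕3` — the shape `dockRel_inner` consumes.

HONEST SCOPE.  Trigonometry of the unit quaternions; an OPERATOR statement about arbitrary bond values (no datum, no tower, no measure); the sup profile `s_{j+1}`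
and its budget are NOT supplied here (px16 g20 ✓`…ContractingSupRecursion`, px17 ✓`…RelativeTowerSupProfile` lineage); nothing of Bałaban's analysis is
asserted ([Balaban1985RegularSpaces] (1.29) p.81 is where the local axial-gauge geodesic charts live); (L♭) along the towers, (H♭), (D♮), (F♮), GAP♯∘
(`stub_uniformFibreGapOrbit`), S2β, crux 20520 and `YM3TorusSU2` are NOT proved; no registered stub is closed; rung R3 = SU(2) YM₃ on T³ — NOT d = 4, NOT
infinite volume, NOT a mass gap, NOT Clay; the Yang–Mills mass gap is NOT proved.
-/

set_option autoImplicit false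

noncomputable section

namespace Summit.QuantumFields.YangMills.Theorems.FluctuationComparisonRegPrIntLS2BetaLogChordComparison

open Finset NormedSpace
open scoped Real RealInnerProductSpace Quaternion
open Literature.MathematicalPhysics.QuantumLattice (su2Quat)
open Literature.MathematicalPhysics.QuantumFieldTheory.Balaban1983to89
open T4CubeChartGnomonic (SU2)
open T4HaarSU2ExpChart (imQuat expPoint su2Quat_expPoint exp_imQuat_re)
open T4ExpWindowSmallField (logVec norm_logVec imVec norm_imVec_sq expPoint_logVec)
open B15Prop1ChartRecentering (imVec_exp_imQuat)
open Summit.QuantumFields.YangMills.Theorems.FluctuationComparisonRegPrIntLS2BetaWhitneyHatLiftRelative (mul_sinc_eq_sin)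
open Summit.QuantumFields.YangMills.Theorems.FluctuationComparisonRegPrIntLS2BetaDistributedHolonomySU2 (norm_logVec_le_pi_div_two_mul_dist1)

/-! ## §1 One-variable trigonometry: `(1 − s²∕6)|x| ≤ |sin x|` on `|x| ≤ s` -/

/-- `(1 − s²∕6)·|x| ≤ |sin x|` for `|x| ≤ s`, `s² ≤ 6` (Mathlib `Real.sin_ge_sub_cube` at `|x|`). [folklore] -/
theorem mu_mul_abs_le_abs_sin {x s : ℝ} (hx : |x| ≤ s) (hs : s ^ 2 ≤ 6) : (1 - s ^ 2 / 6) * |x| ≤ |Real.sin x| := by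
  have h0 : 0 ≤ |x| := abs_nonneg x
  have hcube := Real.sin_ge_sub_cube h0
  have hx2 : |x| ^ 2 ≤ s ^ 2 := pow_le_pow_left₀ h0 hx 2
  have h1 : (1 - s ^ 2 / 6) * |x| ≤ |x| - |x| ^ 3 / 6 := by nlinarith
  have h2 : Real.sin |x| = |Real.sin x| := by
    rcases le_or_gt 0 x with hx0 | hx0
    · rw [abs_of_nonneg hx0]
      have : 0 ≤ Real.sin x := by
        have := Real.sin_ge_sub_cube hx0
        have hx2' : x ^ 2 ≤ 6 := by rw [abs_of_nonneg hx0] at hx2; linarith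
        nlinarith
      rw [abs_of_nonneg this]
    · rw [abs_of_neg hx0, Real.sin_neg]
      have : Real.sin x ≤ 0 := by
        have := Real.sin_ge_sub_cube (neg_nonneg.mpr hx0.le)
        have hx2' : x ^ 2 ≤ 6 := by rw [abs_of_neg hx0] at hx2; nlinarith
        rw [Real.sin_neg] at this
        nlinarith
      rw [abs_of_nonpos this]
  linarith [h2 ▸ hcube]

/-- `(1 − s²∕6)²·y² ≤ 2 − 2cos y` for `|y| ≤ 2s`, `s² ≤ 6` (`2 − 2cos y = 4 sin²(y∕2)` and §1 at `x = y∕2`). [folklore] -/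
theorem mu_sq_mul_sq_le_two_sub_two_cos {y s : ℝ} (hy : |y| ≤ 2 * s) (hs : s ^ 2 ≤ 6) :
    (1 - s ^ 2 / 6) ^ 2 * y ^ 2 ≤ 2 - 2 * Real.cos y := by
  have hx : |y / 2| ≤ s := by rw [abs_div, abs_two]; linarith
  have h := mu_mul_abs_le_abs_sin hx hs
  have hμ : 0 ≤ (1 - s ^ 2 / 6) * |y / 2| := mul_nonneg (by linarith) (abs_nonneg _)
  have h2 : ((1 - s ^ 2 / 6) * |y / 2|) ^ 2 ≤ |Real.sin (y / 2)| ^ 2 := pow_le_pow_left₀ hμ h 2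
  rw [mul_pow, sq_abs, sq_abs] at h2
  have hcos : Real.cos y = 1 - 2 * Real.sin (y / 2) ^ 2 := by
    have := Real.cos_sq (y / 2)
    rw [show 2 * (y / 2) = y by ring] at this
    nlinarith [Real.sin_sq_add_cos_sq (y / 2)]
  rw [hcos]
  nlinarith

/-! ## §2 The reverse chart inequality: `‖v − w‖ ≤ (1 + s²∕3)·‖exp(ιv) − exp(ιw)‖` on the `s`-ball -/

/-- ★★ **THE LOGARITHM IS `(1 + s²∕3)`-LIPSCHITZ AGAINST THE CHORD ON THE `s`-BALL**: `‖v − w‖ ≤ (1 + s²∕3)·‖exp(ιv) − exp(ιw)‖` for `‖v‖, ‖w‖ ≤ s`,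
`s² ≤ 3`.  Both `‖exp(ιv) − exp(ιw)‖²` and `‖v − w‖²` are affine in `⟪v, w⟫ ∈ [−‖v‖‖w‖, ‖v‖‖w‖]`; at the endpoints the claim is
`(1 − s²∕6)²(‖v‖ ∓ ‖w‖)² ≤ 2 − 2cos(‖v‖ ∓ ‖w‖)` (§1); and `(1 − s²∕6)⁻¹ ≤ 1 + s²∕3` for `s² ≤ 3`. [folklore] -/
theorem norm_sub_le_mul_norm_exp_imQuat_sub (v w : EuclideanSpace ℝ (Fin 3)) {s : ℝ} (hv : ‖v‖ ≤ s) (hw : ‖w‖ ≤ s) (hs : s ^ 2 ≤ 3) :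
    ‖v - w‖ ≤ (1 + s ^ 2 / 3) * ‖exp (imQuat v) - exp (imQuat w)‖ := by
  -- quaternion bookkeeping (as in ✓`…WhitneyHatLiftRelative.norm_exp_imQuat_sub_exp_imQuat_le_norm_sub`)
  have norm_sq_eq_re_sq_add : ∀ q : ℍ, ‖q‖ ^ 2 = q.re ^ 2 + ‖imVec q‖ ^ 2 := fun q => by
    rw [norm_imVec_sq, sq, ← Quaternion.normSq_eq_norm_mul_self, Quaternion.normSq_def']
    ring
  have imVec_sub : ∀ p q : ℍ, imVec (p - q) = imVec p - imVec q := fun p q => by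
    ext i; fin_cases i <;> simp [imVec]
  have hsq : ‖exp (imQuat v) - exp (imQuat w)‖ ^ 2 =
      2 - 2 * (Real.cos ‖v‖ * Real.cos ‖w‖) - 2 * (Real.sinc ‖v‖ * Real.sinc ‖w‖) * inner ℝ v w := by
    rw [norm_sq_eq_re_sq_add, imVec_sub, imVec_exp_imQuat, imVec_exp_imQuat, Quaternion.re_sub, exp_imQuat_re, exp_imQuat_re,
      norm_sub_sq_real, norm_smul, norm_smul, real_inner_smul_left, real_inner_smul_right, Real.norm_eq_abs, Real.norm_eq_abs,
      mul_pow, mul_pow, sq_abs, sq_abs]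
    have h1 : Real.sinc ‖v‖ ^ 2 * ‖v‖ ^ 2 = Real.sin ‖v‖ ^ 2 := by rw [← mul_pow, mul_comm, mul_sinc_eq_sin]
    have h2 : Real.sinc ‖w‖ ^ 2 * ‖w‖ ^ 2 = Real.sin ‖w‖ ^ 2 := by rw [← mul_pow, mul_comm, mul_sinc_eq_sin]
    rw [h1, h2]
    nlinarith [Real.sin_sq_add_cos_sq ‖v‖, Real.sin_sq_add_cos_sq ‖w‖]
  have hvw : ‖v - w‖ ^ 2 = ‖v‖ ^ 2 - 2 * inner ℝ v w + ‖w‖ ^ 2 := norm_sub_sq_real v w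
  set a := ‖v‖ with ha
  set b := ‖w‖ with hb
  set t := inner ℝ v w with htdef
  set σ := Real.sinc a * Real.sinc b with hσ
  set μ := 1 - s ^ 2 / 6 with hμ
  have ha0 : 0 ≤ a := norm_nonneg _
  have hb0 : 0 ≤ b := norm_nonneg _
  have hs6 : s ^ 2 ≤ 6 := by linarith
  have ht : |t| ≤ a * b := abs_real_inner_le_norm v w
  have ht1 := (abs_le.mp ht).2
  have ht2 := (abs_le.mp ht).1
  have hss : Real.sin a * Real.sin b = σ * (a * b) := by rw [hσ, ← mul_sinc_eq_sin, ← mul_sinc_eq_sin]; ring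
  -- the two endpoints
  have hEp : μ ^ 2 * (a - b) ^ 2 ≤ 2 - 2 * (Real.cos a * Real.cos b) - 2 * σ * (a * b) := by
    have h := mu_sq_mul_sq_le_two_sub_two_cos (y := a - b) (s := s) (by rw [abs_le]; constructor <;> linarith) hs6
    rw [Real.cos_sub, hss, ← hμ] at h
    linarith
  have hEm : μ ^ 2 * (a + b) ^ 2 ≤ 2 - 2 * (Real.cos a * Real.cos b) + 2 * σ * (a * b) := by
    have h := mu_sq_mul_sq_le_two_sub_two_cos (y := a + b) (s := s) (by rw [abs_le]; constructor <;> linarith) hs6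
    rw [Real.cos_add, hss, ← hμ] at h
    linarith
  -- affine interpolation in `t ∈ [−ab, ab]`
  have key : μ ^ 2 * ‖v - w‖ ^ 2 ≤ ‖exp (imQuat v) - exp (imQuat w)‖ ^ 2 := by
    rw [hsq, hvw]
    rcases eq_or_lt_of_le (mul_nonneg ha0 hb0) with hab | hab
    · have ht0 : t = 0 := by
        have : |t| ≤ 0 := by rw [hab]; exact ht
        exact abs_nonpos_iff.mp this
      rw [ht0]
      nlinarith [hEp, hEm]
    · have h1 : 0 ≤ a * b + t := by linarith
      have h2 : 0 ≤ a * b - t := by linarith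
      have hsum := add_nonpos (mul_nonpos_of_nonneg_of_nonpos h1 (sub_nonpos.mpr hEp)) (mul_nonpos_of_nonneg_of_nonpos h2 (sub_nonpos.mpr hEm))
      -- `hsum : (ab + t)(μ²(a−b)² − E₊) + (ab − t)(μ²(a+b)² − E₋) ≤ 0`, which is `2ab·(goal difference) ≤ 0`
      have hid : (a * b + t) * (μ ^ 2 * (a - b) ^ 2 - (2 - 2 * (Real.cos a * Real.cos b) - 2 * σ * (a * b))) +
          (a * b - t) * (μ ^ 2 * (a + b) ^ 2 - (2 - 2 * (Real.cos a * Real.cos b) + 2 * σ * (a * b))) =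
          2 * (a * b) * (μ ^ 2 * (a ^ 2 - 2 * t + b ^ 2) - (2 - 2 * (Real.cos a * Real.cos b) - 2 * σ * t)) := by ring
      rw [hid] at hsum
      have := nonpos_of_mul_nonpos_right hsum (by positivity)
      linarith
  -- square roots and `μ⁻¹ ≤ 1 + s²∕3`
  have hμ0 : 0 < μ := by rw [hμ]; linarith
  have h1 : μ * ‖v - w‖ ≤ ‖exp (imQuat v) - exp (imQuat w)‖ := by
    have h := Real.sqrt_le_sqrt key
    rwa [Real.sqrt_sq (norm_nonneg _), show μ ^ 2 * ‖v - w‖ ^ 2 = (μ * ‖v - w‖) ^ 2 by ring,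
      Real.sqrt_sq (mul_nonneg hμ0.le (norm_nonneg _))] at h
  have h2 : 1 ≤ μ * (1 + s ^ 2 / 3) := by
    rw [hμ]
    nlinarith [sq_nonneg s]
  have hn := norm_nonneg (v - w)
  calc ‖v - w‖ = 1 * ‖v - w‖ := (one_mul _).symm
    _ ≤ μ * (1 + s ^ 2 / 3) * ‖v - w‖ := mul_le_mul_of_nonneg_right h2 hn
    _ = (1 + s ^ 2 / 3) * (μ * ‖v - w‖) := by ring
    _ ≤ (1 + s ^ 2 / 3) * ‖exp (imQuat v) - exp (imQuat w)‖ := mul_le_mul_of_nonneg_left h1 (by positivity)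

/-! ## §3 The `SU(2)` readings and the `ℓ²` form (L♭) at one level -/

/-- ★★ **(L♭) POINTWISE**: `‖log a − log a₀‖ ≤ (1 + s²∕3)·dist1 (a·a₀⁻¹)` for `‖log a‖, ‖log a₀‖ ≤ s`, `s² ≤ 3` (`a = exp(log a)`, ✓`expPoint_logVec`;
the chord is `‖su2Quat a − su2Quat a₀‖`, ✓`dist1_mul_inv_eq_norm_sub`). [cite: Balaban1985RegularSpaces, (1.29) p.81] -/
theorem norm_logVec_sub_le_mul_dist1 (a a₀ : SU2) {s : ℝ} (ha : ‖logVec (su2Quat a)‖ ≤ s) (ha₀ : ‖logVec (su2Quat a₀)‖ ≤ s) (hs : s ^ 2 ≤ 3) :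
    ‖logVec (su2Quat a) - logVec (su2Quat a₀)‖ ≤ (1 + s ^ 2 / 3) * dist1 (a * a₀⁻¹) := by
  have h := norm_sub_le_mul_norm_exp_imQuat_sub (logVec (su2Quat a)) (logVec (su2Quat a₀)) ha ha₀ hs
  rwa [← su2Quat_expPoint, ← su2Quat_expPoint, expPoint_logVec, expPoint_logVec, ← SU2NearCommuting.dist1_mul_inv_eq_norm_sub] at h

/-- The same with the guards in `dist1` currency (Jordan ✓`norm_logVec_le_pi_div_two_mul_dist1`: `dist1 a ≤ δ` ⟹ `‖log a‖ ≤ (π∕2)δ`):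
`‖log a − log a₀‖ ≤ (1 + (π∕2·δ)²∕3)·dist1 (a·a₀⁻¹)` for `dist1 a, dist1 a₀ ≤ δ`, `(π∕2·δ)² ≤ 3`. [cite: Balaban1985RegularSpaces, (1.29) p.81] -/
theorem norm_logVec_sub_le_mul_dist1_of_dist1_le (a a₀ : SU2) {δ : ℝ} (ha : dist1 a ≤ δ) (ha₀ : dist1 a₀ ≤ δ) (hδ : (π / 2 * δ) ^ 2 ≤ 3) :
    ‖logVec (su2Quat a) - logVec (su2Quat a₀)‖ ≤ (1 + (π / 2 * δ) ^ 2 / 3) * dist1 (a * a₀⁻¹) := by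
  have hπ : 0 ≤ π / 2 := by positivity
  exact norm_logVec_sub_le_mul_dist1 a a₀
    ((norm_logVec_le_pi_div_two_mul_dist1 a).trans (mul_le_mul_of_nonneg_left ha hπ))
    ((norm_logVec_le_pi_div_two_mul_dist1 a₀).trans (mul_le_mul_of_nonneg_left ha₀ hπ)) hδ

/-- ★★ **(L♭) AT ONE LEVEL, `ℓ²` FORM** (the shape ✓`…S2BetaRelGaugeOfRelativeLetter.dockRel_inner` consumes, `r := s²∕3`): over any finite family of bonds
with all arcs `≤ s`, `s² ≤ 3`: `√Σ ‖log U b − log U₀ b‖² ≤ (1 + s²∕3)·√Σ dist1 (U b·(U₀ b)⁻¹)²`. [cite: Balaban1985RegularSpaces, (1.29) p.81] -/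
theorem sqrt_sum_sq_norm_logVec_sub_le {ι : Type*} (S : Finset ι) (U U₀ : ι → SU2) {s : ℝ}
    (hU : ∀ b ∈ S, ‖logVec (su2Quat (U b))‖ ≤ s) (hU₀ : ∀ b ∈ S, ‖logVec (su2Quat (U₀ b))‖ ≤ s) (hs : s ^ 2 ≤ 3) :
    √(∑ b ∈ S, ‖logVec (su2Quat (U b)) - logVec (su2Quat (U₀ b))‖ ^ 2) ≤ (1 + s ^ 2 / 3) * √(∑ b ∈ S, dist1 (U b * (U₀ b)⁻¹) ^ 2) := by
  have hk : 0 ≤ 1 + s ^ 2 / 3 := by positivity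
  rw [← Real.sqrt_sq hk, ← Real.sqrt_mul (sq_nonneg _), mul_sum]
  refine Real.sqrt_le_sqrt (sum_le_sum fun b hb => ?_)
  rw [← mul_pow]
  exact pow_le_pow_left₀ (norm_nonneg _) (norm_logVec_sub_le_mul_dist1 _ _ (hU b hb) (hU₀ b hb) hs) 2

end Summit.QuantumFields.YangMills.Theorems.FluctuationComparisonRegPrIntLS2BetaLogChordComparison

end
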